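/-
Copyright: lit-balaban Phase-2 proof seat p33 (gen 4).  Statement-level skeleton of a published paper; no proof claims beyond what
the kernel checks below.
-/
import Literature.MathematicalPhysics.QuantumFieldTheory.BalabanImbrieJaffe1984to88.BIJ85NoZeroModes309TorusPart2
import Literature.MathematicalPhysics.QuantumFieldTheory.BalabanImbrieJaffe1984to88.BIJ85Eq224Base0
import Literature.MathematicalPhysics.QuantumFieldTheory.BalabanImbrieJaffe1984to88.BIJ85Eq317Proof
import Literature.MathematicalPhysics.QuantumFieldTheory.BalabanImbrieJaffe1984to88.BIJ85SigmaTorusScaling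

/-!
# `BalabanImbrieJaffe1984to88.BIJ85Sigma422Eta` — T. Bałaban, J. Imbrie, A. Jaffe, *Renormalization of the Higgs model: minimizers,
propagators and the stability of mean field theory*, Commun. Math. Phys. **97** (1985) 299–329 [BalabanImbrieJaffe1985]:
**(4.2.2), SECOND MEMBER, ON THE TORI** — `σ_k = η^{−2}I − Q^e_k∂G_{k,Ax}∂^*Q^{e*}_k` with the input `Q^e_kQ^{e*}_k = η^{−2}` of (2.24)
DISCHARGED, and the k = 1 paragraph *"if k = 1, then G_{k,Ax} = C and (4.2.2) agrees with (3.21)"* = the torus model instance of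
(3.15)–(3.20)

statement-level skeleton of published theorems with citation tags; proofs where landed; nothing here is a claim about the Yang–Mills mass gap

PDF held: `paper:balaban1985-cmp97-bij-higgs-minimizers` (journal page = PDF page + 298).  Pages read as images: p. 305 [PDF 7]
(`run/shared/lean/pub/lit-balaban/lit-balaban-r15/pages/1985-cmp97-bij-higgs-minimizers-p007-x2.png`), p. 307–308 [PDF 9–10]
(`…-p009-x2.png`, `…-p010-x2.png`), p. 310 [PDF 12] (`run/shared/lean/pub/pub-balaban/t4/b2b-balaban-t4-lit2/renders/bij1985/…-p012-x2.png`).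

CITATION HEADER (lean-in-tree rule).  Part of the lit-balaban TYPED SKELETON (HOME `run/shared/lean/pub/lit-balaban/`), Phase-2 seat
p33 (gen 4), unit `lit-balaban-p33`; rows **C1.Eq4.2.1-4.2.2** (second member of (4.2.2)), **C1.Eq2.24** (its use), and the k = 1 members
of **C1.Eq3.15-3.16 / C1.Eq3.17-3.18 / C1.Eq3.19-3.21** of `HOME/SKELETON.md` — companion of seat p09's ABSTRACT `BIJ85SigmaForm421`
(`sigmaOp V D Qes = Qes† ∘ (I − ∂G_{k,Ax}∂^*) ∘ Qes`, the FIRST member of (4.2.2), PROVED to satisfy (4.2.1)), of seat p30's torus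
instance `BIJ85Sigma421Torus` (`sigmaTorus`; header: *"NOT here: the second expression of (4.2.2) (needs (2.24) for the edge
composites)"*), of seat p31's `BIJ85Eq224Base0` ((2.24) PROVED outright for the composites) and of seat p30's ABSTRACT (3.15)–(3.18)
`BIJ85Eq317Proof` (C, ∂, Q^e, Q^{e*}, Σ entering as hypotheses `hC`, `hadj`, `hQe`, `h318`).

THE PRINTED TEXT (verbatim).  p. 310 [PDF 12]: *"Comparing (4.2.1) with (4.1.1) we find σ_k = Q^e_k(I − ∂G_{k,Ax}∂^*)Q^{e*}_k =
η^{−2}I − Q^e_k∂G_{k,Ax}∂^*Q^{e*}_k. (4.2.2) Here we have used Q^e_kQ^{e*}_k = η^{−2}, see (2.24). Note that if k = 1, then G_{k,Ax} = C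
and (4.2.2) agrees with (3.21)."* [sic: (3.20)].  p. 305 [PDF 7]: *"⟨f,g⟩_a = Σ_p a^df_pg_p, (2.20) … (Q^ef)(p′) = L^{−(d−2)}Σ_{p∈B(p′)}f(p).
(2.21) Then (Q^{e*}f)(p) = L²f(p′), if p ∈ B^e(p′), 0, otherwise. (2.22) … Q^e_kQ^{e*}_k = L^{2k}I = η^{−2}I … (2.24)"*.  p. 307–308
[PDF 9–10]: *"By the Appendix, with α = ∂ and B = L^{−d/2}Q^{e*}F, we have A_cl = −L^{−d/2}C∂^*Q^{e*}F. (3.15) Here C = (∂^*∂)^{−1},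
restricted to the subspace of A satisfying both QA = 0 and the axial gauge condition. Then by Corollary A2, and A′ = A + A_cl, (3.16)
½Σ_{p∈T₁}|∂A′ + L^{−d/2}Q^{e*}F|² = ½Σ_{p∈T₁}|∂A|² + ½⟨F,ΣF⟩, (3.17) where Σ = L^{−d}Q^e(I − ∂C∂^*)Q^{e*}. (3.18) … This scaling
absorbs the factor L^{−d}, so 𝒮_L⟨F,ΣF⟩ = ⟨f^{(1)}, σ₁f^{(1)}⟩, (3.19) where σ₁ = Q^e(I − ∂C∂^*)Q^{e*} … (3.20) Here Q^{e*} maps the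
unit lattice to the L^{−1} lattice, and ∂C∂^* is an L^{−1} lattice operator."*

THE SETTING (seats p09/p30, untouched): η-plaquette vectors `PlaqSpace P = EuclideanSpace ℝ (Plaq P 0)` carrying the factor `√w`,
`w = η^d`, so that Euclidean norms are the printed η-lattice norms (2.20) (`curlOp w c = √w·∂_c`, `QesOp hd w k = √w·Q^{e*}_k` with
`Q^{e*}_k` = p30's composite `BIJ85Eq531Inputs.QestarIter hd k` = the pull-back of p31's block-size-`L^k` edge geometry
`torusEdgeCellsTo P 0 k k _ hd`, `BIJ85Eq224Base0.QestarIter_eq`); unit-lattice plaquette vectors `UnitPlaqSpace P k` with the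
unweighted product; constraint subspace `V411 P k` (`δ(Q_kA)δ_{k,Ax}(A)`); `G_{k,Ax}` = `axialPropagator`, `∂G_{k,Ax}∂^*` = `curlG`.

WHAT IS PROVED HERE (theorems only; D-0026: no new `def`, no new named fact).
* §1 **`Q^e_k` IS THE ADJOINT OF `Q^{e*}_k`** for the pairings (2.20), on the tori, in the Euclidean encoding: `⟨√w·Q^{e*}_kf, F⟩ =
  √w·η^{−d}·Σ_{p′}f(p′)(Q^e_kF)(p′)` with `Q^e_k` THE PRINTED k-fold edge average (2.21) at block size `L^k` (`Cells.Q` of p31's edge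
  geometry; `inner_QesOp_left`, from `BIJ85CellAverages.Cells.inner_Q_eq_inner_Qstar`); hence `(QesOp)†F = √w·η^{−d}·Q^e_kF`
  (`adjoint_QesOp_apply`) and on an η-field encoded as `√w·F`: `(QesOp)†(√w·F) = (w·η^{−d})·Q^e_kF`, `= Q^e_kF` at `w = η^d`
  (`adjoint_QesOp_encoded`, `adjoint_QesOp_eta`); **(2.24) in the encoding** `(QesOp)† ∘ QesOp = (w·η^{−d})·η^{−2}•I`
  (`adjoint_QesOp_comp_QesOp`, from p31's `Qe_QestarIter531_eta`; `_eta`: `= η^{−2}•I` at `w = η^d`), `‖Q^{e*}_kf‖²_η = η^{−2}‖f‖²`;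
* §2 **(4.2.2), SECOND MEMBER**: `sigmaTorus hd w c k = (w·η^{−d})·η^{−2}•I − (QesOp)† ∘ ∂G_{k,Ax}∂^* ∘ QesOp` (`sigmaTorus_eq_sub`), at
  `w = η^d` verbatim **`σ_k = η^{−2}I − Q^e_k∂G_{k,Ax}∂^*Q^{e*}_k`** (`sigmaTorus_eq_eta`); the form `⟨f, σ_kf⟩ = η^{−2}‖f‖² −
  ⟨∂^*Q^{e*}_kf, G_{k,Ax}∂^*Q^{e*}_kf⟩ = η^{−2}‖f‖² − ‖∂G_{k,Ax}∂^*Q^{e*}_kf‖²` (`inner_sigmaTorus_eq`, `inner_sigmaTorus_eq_sub_norm_sq`) and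
  `0 ≤ ⟨f, σ_kf⟩ ≤ η^{−2}‖f‖²` (`sigmaTorus_form_le(_eta)`; the uniform LOWER bound (4.2.3) is Sect. 7 and is not claimed here);
* §3 **k = 1: "G_{k,Ax} = C and (4.2.2) agrees with (3.20)"**, the torus discharge of p30's abstract (3.15)–(3.18): `ℋ₀ = V411 P k`
  (k = 1: *"the subspace of A satisfying both QA = 0 and the axial gauge condition"*, `mem_V411_one`), `∂|ℋ₀` injective (no zero modes,
  seat p33 gen 2 `hD_holds`; `injective_curl_V411`), `C := (∂^*∂)^{−1}` on `ℋ₀` = `formInv (curlOp ∘ ι)` an HONEST inverse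
  (`curlAdj_curl_C` = p30's `hC`), `G_{k,Ax} = ιCι^*` (`axialPropagator_eq_C`), `∂G_{k,Ax}∂^* = ∂C∂^*` (`curlG_eq_curl_C_curlAdj`), so
  `σ_k = Q^e(I − ∂C∂^*)Q^{e*}` (3.20) (`sigmaTorus_eq_320`); **(3.15)** `A_cl = −L^{−d/2}C∂^*Q^{e*}F` minimises (`eq315_torus`);
  **(3.17)–(3.18)** `½‖∂(A + A_cl) + L^{−d/2}Q^{e*}F‖² = ½‖∂A‖² + ½⟨F, ΣF⟩`, `Σ = L^{−d}·σ` (`eq317_torus`: every hypothesis of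
  `BIJ85Eq317Proof.eq317` supplied); **(3.19)** *"the scaling absorbs the factor L^{−d}"*: in Sect. 3's units (`k = 1`, `w = 1`, `c = 1`)
  `Σ = L^{−d}•sigmaTorus hd 1 1 1 = sigmaTorus hd (η^d) 1 1 = σ₁`, η = L^{−1} (`Sigma318_eq_sigmaOne`, p30's `sigmaTorus_scale_w`;
  `eq317_sigmaOne`).
Standing hypotheses as in the companions: `2 ≤ d` (edge plaquettes exist), standing range `k ≤ m + K`, `w > 0` (or `w ≥ 0` where only
algebra is used), `c ≠ 0`.  Unit `lit-balaban-p33` (literature-prover-lit-balaban-p33-g4-0), 2026-08-21.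
-/

open scoped BigOperators RealInnerProductSpace

namespace Literature.MathematicalPhysics.QuantumFieldTheory.BalabanImbrieJaffe1984to88.BIJ85Sigma422Eta

open Literature.MathematicalPhysics.QuantumFieldTheory.Balaban1983to89
open LatticeFieldCalculus BIJ85CellAverages BIJ85Eq531Inputs BIJ85AxialPropagator411 BIJ85AxialMinimizer413 BIJ85SigmaForm421
  BIJ85Sigma421Torus BIJ85NoZeroModes309Torus BIJ85NoZeroModes309TorusPart2 BIJ85Eq224Base0 BIJ85SigmaTorusScaling

variable {P : Params}

/-! ## 0. Plumbing: components and Euclidean pairings -/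

/-- Components are unchanged by p30's identification `toU`. [folklore] -/
@[simp] private theorem toU_apply' (k : ℕ) (f : Plaq P k → ℝ) (p : Plaq P k) : toU P k f p = f p := rfl

/-- Components are unchanged by p30's identification `toP`. [folklore] -/
@[simp] private theorem toP_apply' (F : Plaq P 0 → ℝ) (p : Plaq P 0) : toP P F p = F p := rfl

/-- The Euclidean pairing of η-plaquette vectors as a sum over plaquettes. [folklore] -/
private theorem inner_plaq (x y : PlaqSpace P) : ⟪x, y⟫ = ∑ p : Plaq P 0, x p * y p := by
  simp [PiLp.inner_apply, mul_comm]

/-- The Euclidean pairing of unit-lattice plaquette vectors as a sum over plaquettes ((2.20) with `a = 1`). [folklore] -/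
private theorem inner_unit {k : ℕ} (x y : UnitPlaqSpace P k) : ⟪x, y⟫ = ∑ p : Plaq P k, x p * y p := by
  simp [PiLp.inner_apply, mul_comm]

/-- The block size of the k-fold edge geometry as a real number: `(L^k : ℕ) = L^k`. [cite: BalabanImbrieJaffe1985, (2.24) p.305] -/
private theorem edgeL_cast (hd : 2 ≤ P.d) (k : ℕ) :
    ((torusEdgeCellsTo P 0 k k (Nat.zero_add k) hd).L : ℝ) = (P.L : ℝ) ^ k := by
  rw [show (torusEdgeCellsTo P 0 k k (Nat.zero_add k) hd).L = P.L ^ k from rfl, Nat.cast_pow]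

/-- `η^{−1} = L^k`. [cite: BalabanImbrieJaffe1985, (2.24) p.305] -/
theorem eta_inv (P : Params) (k : ℕ) : (P.eta k)⁻¹ = (P.L : ℝ) ^ k := by
  rw [Params.eta, inv_pow, inv_inv]

/-- `0 < η`. [cite: BalabanImbrieJaffe1985, (2.24) p.305] -/
theorem eta_pos (P : Params) (k : ℕ) : 0 < P.eta k :=
  pow_pos (inv_pos.mpr (Nat.cast_pos.mpr P.L_pos)) _

/-- At the physical weight `w = η^d` the ratio `w·η^{−d}` is `1`. [cite: BalabanImbrieJaffe1985, (2.20) p.305] -/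
theorem eta_pow_mul_eta_inv_pow (P : Params) (k : ℕ) : (P.eta k) ^ P.d * ((P.eta k)⁻¹) ^ P.d = 1 := by
  rw [← mul_pow, mul_inv_cancel₀ (eta_pos P k).ne', one_pow]

/-- The k-fold edge average (2.21) is homogeneous: `Q^e_k(a·F) = a·Q^e_kF`. [cite: BalabanImbrieJaffe1985, (2.21) p.305] -/
private theorem cellsQ_const_mul (G : Cells) (a : ℝ) (F : G.F → ℝ) (c : G.C) :
    G.Q (fun p => a * F p) c = a * G.Q F c := by
  rw [Cells.Q, Cells.Q, ← Finset.mul_sum]; ring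

/-! ## 1. `Q^e_k` is the adjoint of `Q^{e*}_k`; (2.24) in the Euclidean encoding -/

/-- **`Q^e_k` is the adjoint of `Q^{e*}_k` for the pairings (2.20)**, on the tori and in seat p09/p30's encoding: for a unit-lattice
plaquette vector `f` and an η-plaquette vector `F`, `⟨Q^{e*}_kf·√w, F⟩ = √w·η^{−d}·Σ_{p′} f(p′)(Q^e_kF)(p′)`, where `Q^e_k` is THE
PRINTED k-fold edge average (2.21) at block size `L^k` (`(Q^e_kF)(p′) = L^{−k(d−2)}Σ_{p∈B^e_k(p′)}F(p)`, the `Cells.Q` of seat p31's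
edge geometry `torusEdgeCellsTo P 0 k k`) — seat p31's `QestarIter_eq` and `BIJ85CellAverages.Cells.inner_Q_eq_inner_Qstar`
(*"Q^* is the adjoint in the scalar product"*, p. 303/305); standing range, `2 ≤ d`. [cite: BalabanImbrieJaffe1985, (2.21)–(2.22) p.305] -/
theorem inner_QesOp_left (hd : 2 ≤ P.d) {k : ℕ} (hk : k ≤ P.m + P.K) (w : ℝ) (f : UnitPlaqSpace P k) (F : PlaqSpace P) :
    ⟪QesOp (P := P) hd w k f, F⟫ =
      Real.sqrt w * ((P.eta k)⁻¹) ^ P.d *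
        ∑ p' : Plaq P k, f p' * (torusEdgeCellsTo P 0 k k (Nat.zero_add k) hd).Q (fun p => F p) p' := by
  set G := torusEdgeCellsTo P 0 k k (Nat.zero_add k) hd with hG
  have hcells := Cells.inner_Q_eq_inner_Qstar G (fun p => F p) (fun q => f q)
  unfold Cells.inner at hcells
  simp only [one_pow, one_mul] at hcells
  -- `hcells : Σ_c (L^k)^d·(Q F)(c)·f(c) = Σ_p F(p)·(Q^* f)(p)`
  have hLd : ((G.L : ℝ)) ^ G.d = ((P.eta k)⁻¹) ^ P.d := by
    rw [hG, edgeL_cast, eta_inv]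
  rw [inner_plaq]
  have h1 : ∀ p : Plaq P 0, QesOp (P := P) hd w k f p * F p = Real.sqrt w * (F p * G.Qstar (fun q => f q) p) := by
    intro p
    rw [QesOp_apply, QestarIter_eq hd k hk]
    ring
  simp_rw [h1]
  rw [← Finset.mul_sum, ← hcells, hLd, Finset.mul_sum, Finset.mul_sum]
  refine Finset.sum_congr rfl fun c _ => ?_
  ring

/-- **`(Q^{e*}_k)† = √w·η^{−d}·Q^e_k` componentwise**: the Euclidean adjoint of seat p30's `QesOp hd w k` (`= √w·Q^{e*}_k`) is
`F ↦ √w·η^{−d}·Q^e_kF` with `Q^e_k` the printed k-fold edge average (2.21) (standing range, `2 ≤ d`).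
[cite: BalabanImbrieJaffe1985, (2.21)–(2.22) p.305] -/
theorem adjoint_QesOp_apply (hd : 2 ≤ P.d) {k : ℕ} (hk : k ≤ P.m + P.K) (w : ℝ) (F : PlaqSpace P) (p' : Plaq P k) :
    LinearMap.adjoint (QesOp (P := P) hd w k) F p' =
      Real.sqrt w * ((P.eta k)⁻¹) ^ P.d * (torusEdgeCellsTo P 0 k k (Nat.zero_add k) hd).Q (fun p => F p) p' := by
  set g : UnitPlaqSpace P k :=
    toU P k (fun q => Real.sqrt w * ((P.eta k)⁻¹) ^ P.d * (torusEdgeCellsTo P 0 k k (Nat.zero_add k) hd).Q (fun p => F p) q)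
    with hg
  have key : LinearMap.adjoint (QesOp (P := P) hd w k) F = g := by
    apply ext_inner_left ℝ
    intro f
    rw [LinearMap.adjoint_inner_right, inner_QesOp_left hd hk w f F, inner_unit, Finset.mul_sum]
    refine Finset.sum_congr rfl fun q _ => ?_
    rw [hg, toU_apply']
    ring
  rw [key, hg, toU_apply']

/-- **`Q^e_k` IS the adjoint of `Q^{e*}_k`, encoded**: an η-plaquette FIELD `F` is the vector `√w·F` of `PlaqSpace P` (seat p09's
convention), and on it `(QesOp)†(√w·F) = (w·η^{−d})·Q^e_kF` — the factor `w·η^{−d}` being `1` at the physical weight `w = η^d`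
(`adjoint_QesOp_eta`). [cite: BalabanImbrieJaffe1985, (2.21)–(2.22) p.305] -/
theorem adjoint_QesOp_encoded (hd : 2 ≤ P.d) {k : ℕ} (hk : k ≤ P.m + P.K) {w : ℝ} (hw : 0 ≤ w) (F : Plaq P 0 → ℝ) :
    LinearMap.adjoint (QesOp (P := P) hd w k) (Real.sqrt w • toP P F) =
      (w * ((P.eta k)⁻¹) ^ P.d) • toU P k ((torusEdgeCellsTo P 0 k k (Nat.zero_add k) hd).Q F) := by
  ext p'
  rw [adjoint_QesOp_apply hd hk]
  simp only [PiLp.smul_apply, smul_eq_mul, toU_apply', toP_apply']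
  rw [cellsQ_const_mul, ← mul_assoc, mul_right_comm (Real.sqrt w) _ (Real.sqrt w), Real.mul_self_sqrt hw]

/-- **At `w = η^d`: `(Q^{e*}_k)† = Q^e_k` on η-fields** — verbatim the adjoint pair (2.21)–(2.22) (k-fold, block size `L^k`) for the
pairings `⟨·,·⟩_η` (fine) and `⟨·,·⟩_1` (unit lattice) of (2.20). [cite: BalabanImbrieJaffe1985, (2.21)–(2.22) p.305] -/
theorem adjoint_QesOp_eta (hd : 2 ≤ P.d) {k : ℕ} (hk : k ≤ P.m + P.K) (F : Plaq P 0 → ℝ) :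
    LinearMap.adjoint (QesOp (P := P) hd ((P.eta k) ^ P.d) k) (Real.sqrt ((P.eta k) ^ P.d) • toP P F) =
      toU P k ((torusEdgeCellsTo P 0 k k (Nat.zero_add k) hd).Q F) := by
  rw [adjoint_QesOp_encoded hd hk (pow_nonneg (eta_pos P k).le _), eta_pow_mul_eta_inv_pow, one_smul]

/-- **(2.24) in the Euclidean encoding**: `(QesOp)† ∘ QesOp = (w·η^{−d})·η^{−2}•I` — *"Here we have used Q^e_kQ^{e*}_k = η^{−2}, see
(2.24)"* (p. 310), the identity `Q^e_kQ^{e*}_k = η^{−2}I` being seat p31's `BIJ85Eq224Base0.Qe_QestarIter531_eta` (PROVED outright on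
the tori); `w ≥ 0`, standing range, `2 ≤ d`. [cite: BalabanImbrieJaffe1985, (2.24) p.305] -/
theorem adjoint_QesOp_comp_QesOp (hd : 2 ≤ P.d) {k : ℕ} (hk : k ≤ P.m + P.K) {w : ℝ} (hw : 0 ≤ w) :
    LinearMap.adjoint (QesOp (P := P) hd w k) ∘ₗ QesOp (P := P) hd w k =
      (w * ((P.eta k)⁻¹) ^ P.d * ((P.eta k)⁻¹) ^ 2) • LinearMap.id := by
  refine LinearMap.ext fun f => ?_
  ext p'
  rw [LinearMap.comp_apply, adjoint_QesOp_apply hd hk, LinearMap.smul_apply, LinearMap.id_apply, PiLp.smul_apply,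
    smul_eq_mul]
  have h1 : (fun p => QesOp (P := P) hd w k f p) = fun p => Real.sqrt w * QestarIter hd k (fun q => f q) p :=
    funext fun p => QesOp_apply hd w k f p
  rw [h1, cellsQ_const_mul, Qe_QestarIter531_eta hd hk]
  have hs : Real.sqrt w * Real.sqrt w = w := Real.mul_self_sqrt hw
  linear_combination (((P.eta k)⁻¹) ^ P.d * (((P.eta k)⁻¹) ^ 2 * f p')) * hs

/-- **(2.24) at the physical weight `w = η^d`**: `(Q^{e*}_k)† ∘ Q^{e*}_k = η^{−2}•I`, i.e. `Q^e_kQ^{e*}_k = η^{−2}I` read in the encoding.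
[cite: BalabanImbrieJaffe1985, (2.24) p.305] -/
theorem adjoint_QesOp_comp_QesOp_eta (hd : 2 ≤ P.d) {k : ℕ} (hk : k ≤ P.m + P.K) :
    LinearMap.adjoint (QesOp (P := P) hd ((P.eta k) ^ P.d) k) ∘ₗ QesOp (P := P) hd ((P.eta k) ^ P.d) k =
      (((P.eta k)⁻¹) ^ 2) • LinearMap.id := by
  rw [adjoint_QesOp_comp_QesOp hd hk (pow_nonneg (eta_pos P k).le _), eta_pow_mul_eta_inv_pow, one_mul]

/-- `‖Q^{e*}_kf‖² = (w·η^{−d})·η^{−2}·‖f‖²` in the encoding (`w ≥ 0`). [cite: BalabanImbrieJaffe1985, (2.24) p.305] -/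
theorem norm_QesOp_sq (hd : 2 ≤ P.d) {k : ℕ} (hk : k ≤ P.m + P.K) {w : ℝ} (hw : 0 ≤ w) (f : UnitPlaqSpace P k) :
    ‖QesOp (P := P) hd w k f‖ ^ 2 = w * ((P.eta k)⁻¹) ^ P.d * ((P.eta k)⁻¹) ^ 2 * ‖f‖ ^ 2 := by
  rw [← real_inner_self_eq_norm_sq, ← LinearMap.adjoint_inner_right, ← LinearMap.comp_apply,
    adjoint_QesOp_comp_QesOp hd hk hw, LinearMap.smul_apply, LinearMap.id_apply, real_inner_smul_right,
    real_inner_self_eq_norm_sq]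

/-- **`‖Q^{e*}_kf‖²_η = η^{−2}‖f‖²`** at the physical weight `w = η^d` (the printed η-lattice norm (2.20) of `Q^{e*}_kf` against the
unit-lattice norm of `f`). [cite: BalabanImbrieJaffe1985, (2.24) p.305] -/
theorem norm_QesOp_sq_eta (hd : 2 ≤ P.d) {k : ℕ} (hk : k ≤ P.m + P.K) (f : UnitPlaqSpace P k) :
    ‖QesOp (P := P) hd ((P.eta k) ^ P.d) k f‖ ^ 2 = ((P.eta k)⁻¹) ^ 2 * ‖f‖ ^ 2 := by
  rw [norm_QesOp_sq hd hk (pow_nonneg (eta_pos P k).le _), eta_pow_mul_eta_inv_pow, one_mul]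

/-! ## 2. (4.2.2), second member: `σ_k = η^{−2}I − Q^e_k∂G_{k,Ax}∂^*Q^{e*}_k` on the torus -/

/-- **(4.2.2), second member, general weight**: `sigmaTorus hd w c k = (w·η^{−d})·η^{−2}•I − (Q^{e*}_k)† ∘ ∂G_{k,Ax}∂^* ∘ Q^{e*}_k`
— the first member `Q^e_k(I − ∂G_{k,Ax}∂^*)Q^{e*}_k` (seat p09's `sigmaOp`, by definition of `sigmaTorus`) expanded with (2.24)
(`adjoint_QesOp_comp_QesOp`); the ring identity is r15's `BIJ85Sect4Statements.eq422`, here between the two plaquette spaces;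
`w ≥ 0`, standing range, `2 ≤ d`. [cite: BalabanImbrieJaffe1985, (4.2.2) p.310] -/
theorem sigmaTorus_eq_sub (hd : 2 ≤ P.d) {k : ℕ} (hk : k ≤ P.m + P.K) {w : ℝ} (hw : 0 ≤ w) (c : ℝ) :
    sigmaTorus (P := P) hd w c k =
      (w * ((P.eta k)⁻¹) ^ P.d * ((P.eta k)⁻¹) ^ 2) • LinearMap.id -
        LinearMap.adjoint (QesOp (P := P) hd w k) ∘ₗ curlG (V411 P k) (curlOp (P := P) w c) ∘ₗ QesOp (P := P) hd w k := by
  unfold sigmaTorus sigmaOp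
  rw [LinearMap.sub_comp, LinearMap.id_comp, LinearMap.comp_sub, adjoint_QesOp_comp_QesOp hd hk hw]

/-- **(4.2.2), SECOND MEMBER, AS PRINTED** (`w = η^d`): *"σ_k = Q^e_k(I − ∂G_{k,Ax}∂^*)Q^{e*}_k = η^{−2}I − Q^e_k∂G_{k,Ax}∂^*Q^{e*}_k.
(4.2.2) Here we have used Q^e_kQ^{e*}_k = η^{−2}, see (2.24)"* — ON THE TORUS, with (2.24) DISCHARGED (`Q^e_k` = the adjoint
`(Q^{e*}_k)†`, §1); standing range, `2 ≤ d`, any curl normalization `c`. [cite: BalabanImbrieJaffe1985, (4.2.2) p.310] -/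
theorem sigmaTorus_eq_eta (hd : 2 ≤ P.d) {k : ℕ} (hk : k ≤ P.m + P.K) (c : ℝ) :
    sigmaTorus (P := P) hd ((P.eta k) ^ P.d) c k =
      (((P.eta k)⁻¹) ^ 2) • LinearMap.id -
        LinearMap.adjoint (QesOp (P := P) hd ((P.eta k) ^ P.d) k) ∘ₗ
          curlG (V411 P k) (curlOp (P := P) ((P.eta k) ^ P.d) c) ∘ₗ QesOp (P := P) hd ((P.eta k) ^ P.d) k := by
  rw [sigmaTorus_eq_sub hd hk (pow_nonneg (eta_pos P k).le _), eta_pow_mul_eta_inv_pow, one_mul]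

/-- **The form of the second member**: `⟨f, σ_kf⟩ = (w·η^{−d})·η^{−2}‖f‖² − ⟨∂^*Q^{e*}_kf, G_{k,Ax}∂^*Q^{e*}_kf⟩` (`∂^*` = the adjoint of
`curlOp w c`, `G_{k,Ax}` = `axialPropagator (V411 P k) (curlOp w c)`; seat p09's `inner_sigmaOp` with `‖Q^{e*}_kf‖²` evaluated by
(2.24)); `w ≥ 0`. [cite: BalabanImbrieJaffe1985, (4.2.2) p.310] -/
theorem inner_sigmaTorus_eq (hd : 2 ≤ P.d) {k : ℕ} (hk : k ≤ P.m + P.K) {w : ℝ} (hw : 0 ≤ w) (c : ℝ) (f : UnitPlaqSpace P k) :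
    ⟪f, sigmaTorus (P := P) hd w c k f⟫ =
      w * ((P.eta k)⁻¹) ^ P.d * ((P.eta k)⁻¹) ^ 2 * ‖f‖ ^ 2 -
        ⟪LinearMap.adjoint (curlOp (P := P) w c) (QesOp (P := P) hd w k f),
          axialPropagator (V411 P k) (curlOp (P := P) w c)
            (LinearMap.adjoint (curlOp (P := P) w c) (QesOp (P := P) hd w k f))⟫ := by
  unfold sigmaTorus
  rw [inner_sigmaOp, norm_QesOp_sq hd hk hw]

/-- **The second member with the projection property** (p. 311: *"∂G_{k,Ax}∂^* is a projection operator"*):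
`⟨f, σ_kf⟩ = (w·η^{−d})·η^{−2}‖f‖² − ‖∂G_{k,Ax}∂^*Q^{e*}_kf‖²` — seat p09's `inner_sigmaOp_eq_norm_sq`/`norm_sq_split` (no zero modes,
seat p33 gen 2 `hD_holds`), with `‖Q^{e*}_kf‖²` evaluated by (2.24); `w > 0`, `c ≠ 0`, standing range.
[cite: BalabanImbrieJaffe1985, (4.2.2) p.310] -/
theorem inner_sigmaTorus_eq_sub_norm_sq (hd : 2 ≤ P.d) {k : ℕ} (hk : k ≤ P.m + P.K) {w : ℝ} (hw : 0 < w) {c : ℝ} (hc : c ≠ 0)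
    (f : UnitPlaqSpace P k) :
    ⟪f, sigmaTorus (P := P) hd w c k f⟫ =
      w * ((P.eta k)⁻¹) ^ P.d * ((P.eta k)⁻¹) ^ 2 * ‖f‖ ^ 2 -
        ‖curlG (V411 P k) (curlOp (P := P) w c) (QesOp (P := P) hd w k f)‖ ^ 2 := by
  have hD := noZeroModes_V411 hw c k (hD_holds hk hc)
  unfold sigmaTorus
  rw [inner_sigmaOp_eq_norm_sq hD, ← norm_QesOp_sq hd hk hw.le f,
    norm_sq_split hD (V := V411 P k) (D := curlOp (P := P) w c) (QesOp (P := P) hd w k f)]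
  ring

/-- **`0 ≤ σ_k ≤ (w·η^{−d})·η^{−2}I` in form sense** on the torus: the upper companion of the uniform LOWER bound (4.2.3)/(7.1.1)
(which is Sect. 7 and is NOT claimed here) — p30's `sigmaTorus_form_bounds` with `‖Q^{e*}_kf‖²` evaluated by (2.24); `w > 0`, `c ≠ 0`,
standing range. [cite: BalabanImbrieJaffe1985, (4.2.2) p.310] -/
theorem sigmaTorus_form_le (hd : 2 ≤ P.d) {k : ℕ} (hk : k ≤ P.m + P.K) {w : ℝ} (hw : 0 < w) {c : ℝ} (hc : c ≠ 0)
    (f : UnitPlaqSpace P k) :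
    0 ≤ ⟪f, sigmaTorus (P := P) hd w c k f⟫ ∧
      ⟪f, sigmaTorus (P := P) hd w c k f⟫ ≤ w * ((P.eta k)⁻¹) ^ P.d * ((P.eta k)⁻¹) ^ 2 * ‖f‖ ^ 2 := by
  rw [← norm_QesOp_sq hd hk hw.le f]
  exact sigmaTorus_form_bounds_holds hd hk hw hc f

/-- **`0 ≤ ⟨f, σ_kf⟩ ≤ η^{−2}‖f‖²`** at the physical weight `w = η^d` (`c ≠ 0`, standing range). [cite: BalabanImbrieJaffe1985, (4.2.2) p.310] -/
theorem sigmaTorus_form_le_eta (hd : 2 ≤ P.d) {k : ℕ} (hk : k ≤ P.m + P.K) {c : ℝ} (hc : c ≠ 0) (f : UnitPlaqSpace P k) :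
    0 ≤ ⟪f, sigmaTorus (P := P) hd ((P.eta k) ^ P.d) c k f⟫ ∧
      ⟪f, sigmaTorus (P := P) hd ((P.eta k) ^ P.d) c k f⟫ ≤ ((P.eta k)⁻¹) ^ 2 * ‖f‖ ^ 2 := by
  have h := sigmaTorus_form_le hd hk (pow_pos (eta_pos P k) P.d) hc f
  rwa [eta_pow_mul_eta_inv_pow, one_mul] at h

/-! ## 3. k = 1: "G_{k,Ax} = C and (4.2.2) agrees with (3.20)" — (3.15)–(3.20) on the torus -/

section Abstract

variable {E F : Type*} [NormedAddCommGroup E] [InnerProductSpace ℝ E] [FiniteDimensional ℝ E]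
  [NormedAddCommGroup F] [InnerProductSpace ℝ F] [FiniteDimensional ℝ F]

/-- **"G_{k,Ax} = C"** (p. 310, k = 1; p. 307: *"Here C = (∂^*∂)^{−1}, restricted to the subspace of A satisfying both QA = 0 and
the axial gauge condition"*): seat p09's `G_{k,Ax}` IS `ι_V C ι_V^*` with `C = (∂|_V^*∂|_V)^{−1}` the inverse on the constraint subspace
(`BIJ85AxialPropagator411.formInv (D ∘ ι_V)`) — by definition. [cite: BalabanImbrieJaffe1985, (3.15) p.307] -/
theorem axialPropagator_eq_C (V : Submodule ℝ E) (D : E →ₗ[ℝ] F) :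
    axialPropagator V D = V.subtype ∘ₗ formInv (D ∘ₗ V.subtype) ∘ₗ LinearMap.adjoint V.subtype := rfl

/-- **`∂G_{k,Ax}∂^* = ∂C∂^*`** with `∂` restricted to the constraint subspace (`α = ∂|_V`, `α^* = ι_V^*∂^*` its adjoint, as in
Proposition A1 with *"α = ∂"*, p. 307): `curlG V D = α ∘ C ∘ α^*`. [cite: BalabanImbrieJaffe1985, (3.18) p.307] -/
theorem curlG_eq_curl_C_curlAdj (V : Submodule ℝ E) (D : E →ₗ[ℝ] F) :
    curlG V D = (D ∘ₗ V.subtype) ∘ₗ formInv (D ∘ₗ V.subtype) ∘ₗ LinearMap.adjoint (D ∘ₗ V.subtype) := by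
  refine LinearMap.ext fun x => ?_
  simp only [curlG, axialPropagator, LinearMap.adjoint_comp, LinearMap.comp_apply]

end Abstract

section KOne

variable {k : ℕ} {w c : ℝ}

/-- **No zero modes ⇒ `∂|_{ℋ₀}` is one-to-one**: `curlOp w c ∘ ι_V` is injective on the constraint subspace `V411 P k` (seat p33 gen 2
`hD_holds`; `w > 0`, `c ≠ 0`, standing range). [cite: BalabanImbrieJaffe1985, §4.1 p.309] -/
theorem injective_curl_V411 (hk : k ≤ P.m + P.K) (hw : 0 < w) (hc : c ≠ 0) :
    Function.Injective (curlOp (P := P) w c ∘ₗ (V411 P k).subtype) := by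
  intro v u h
  have h0 : (curlOp (P := P) w c ∘ₗ (V411 P k).subtype) (v - u) = 0 := by rw [map_sub, h, sub_self]
  exact sub_eq_zero.1 (noZeroModes_V411_holds hk hw hc (v - u) h0)

/-- **`C = (∂^*∂)^{−1}` on `ℋ₀` is an honest inverse**: `∂^*∂C = I` on `V411 P k` for `C = formInv (curlOp w c ∘ ι_V)`, `∂^*` the adjoint
of the restricted curl — seat p30's hypothesis `hC` of `BIJ85Eq317Proof`, DISCHARGED on the torus (`w > 0`, `c ≠ 0`, standing range).
[cite: BalabanImbrieJaffe1985, (3.15) p.307] -/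
theorem curlAdj_curl_C (hk : k ≤ P.m + P.K) (hw : 0 < w) (hc : c ≠ 0) (x : V411 P k) :
    LinearMap.adjoint (curlOp (P := P) w c ∘ₗ (V411 P k).subtype)
        ((curlOp (P := P) w c ∘ₗ (V411 P k).subtype)
          (formInv (curlOp (P := P) w c ∘ₗ (V411 P k).subtype) x)) = x := by
  have h := formOp_formInv (injective_curl_V411 (P := P) hk hw hc) x
  simpa only [formOp, LinearMap.comp_apply] using h

/-- **(3.20) = (4.2.2)**: `σ_k = Q^e(I − ∂C∂^*)Q^{e*}` with `C = (∂^*∂)^{−1}` on `ℋ₀ = V411 P k` and `∂` restricted to `ℋ₀` — at k = 1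
verbatim *"σ₁ = Q^e(I − ∂C∂^*)Q^{e*} … (3.20) Here Q^{e*} maps the unit lattice to the L^{−1} lattice, and ∂C∂^* is an L^{−1} lattice
operator"*, the torus `sigmaTorus hd w c 1` (η = L^{−1}); *"if k = 1, then G_{k,Ax} = C and (4.2.2) agrees with (3.21) [(3.20)]"*
(p. 310). [cite: BalabanImbrieJaffe1985, (3.20) p.308] -/
theorem sigmaTorus_eq_320 (hd : 2 ≤ P.d) (w c : ℝ) (k : ℕ) :
    sigmaTorus (P := P) hd w c k =
      LinearMap.adjoint (QesOp (P := P) hd w k) ∘ₗ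
        (LinearMap.id -
          (curlOp (P := P) w c ∘ₗ (V411 P k).subtype) ∘ₗ formInv (curlOp (P := P) w c ∘ₗ (V411 P k).subtype) ∘ₗ
            LinearMap.adjoint (curlOp (P := P) w c ∘ₗ (V411 P k).subtype)) ∘ₗ
        QesOp (P := P) hd w k := by
  unfold sigmaTorus sigmaOp
  rw [curlG_eq_curl_C_curlAdj]

/-- **`ℋ₀` at k = 1** is *"the subspace of A satisfying both QA = 0 and the axial gauge condition"* (p. 307): `v ∈ V411 P 1` iff the bond
field has vanishing average (2.13) and is axial (3.4) (`(4.1.2)` at k = 1, `deltaAx_one`). [cite: BalabanImbrieJaffe1985, (3.15) p.307] -/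
theorem mem_V411_one (v : BondSpace P) :
    v ∈ V411 P 1 ↔ bondAvg ((toE P).symm v) = 0 ∧ IsAxial ((toE P).symm v) := by
  rw [mem_V411, deltaAx_one]
  exact Iff.rfl

/-- **(3.15) on the torus**: `A_cl = −l·C∂^*Q^{e*}F` (`l = L^{−d/2}` in print) MINIMISES `h(A) = ½‖∂A + l·Q^{e*}F‖²` over `ℋ₀ = V411 P k` —
seat p30's abstract `BIJ85Eq317Proof.eq315_min` (Proposition A1) with EVERY hypothesis supplied: `α = ∂|_{ℋ₀}`, `α^*` its adjoint,
`C = (∂^*∂)^{−1}` honest (`curlAdj_curl_C`); `w > 0`, `c ≠ 0`, standing range, `2 ≤ d`. [cite: BalabanImbrieJaffe1985, (3.15) p.307] -/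
theorem eq315_torus (hd : 2 ≤ P.d) (hk : k ≤ P.m + P.K) (hw : 0 < w) (hc : c ≠ 0) (l : ℝ) (F : UnitPlaqSpace P k)
    (x : V411 P k) :
    BIJ85AppAStatements.hForm (curlOp (P := P) w c ∘ₗ (V411 P k).subtype) (l • QesOp (P := P) hd w k F)
        (-(l • formInv (curlOp (P := P) w c ∘ₗ (V411 P k).subtype)
          (LinearMap.adjoint (curlOp (P := P) w c ∘ₗ (V411 P k).subtype) (QesOp (P := P) hd w k F)))) ≤
      BIJ85AppAStatements.hForm (curlOp (P := P) w c ∘ₗ (V411 P k).subtype) (l • QesOp (P := P) hd w k F) x :=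
  BIJ85Eq317Proof.eq315_min _ _ (fun y z => (LinearMap.adjoint_inner_right _ y z).symm) _ (curlAdj_curl_C hk hw hc) _ l F x

/-- **(3.16)–(3.18) on the torus**: with `A′ = A + A_cl` (3.16), *"½Σ|∂A′ + L^{−d/2}Q^{e*}F|² = ½Σ|∂A|² + ½⟨F,ΣF⟩, (3.17) where
Σ = L^{−d}Q^e(I − ∂C∂^*)Q^{e*}. (3.18)"* — for every `A ∈ ℋ₀ = V411 P k` and every unit-lattice plaquette vector `F`, with `l` for
`L^{−d/2}` and `Σ = l²·σ_k` (`σ_k = Q^e(I − ∂C∂^*)Q^{e*}`, `sigmaTorus_eq_320`, `Q^e = (Q^{e*})†` §1): seat p30's abstract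
`BIJ85Eq317Proof.eq317` (Corollary A2 + Proposition A1) with EVERY hypothesis (`hadj`, `hC`, `hQe`, `h318`) supplied on the torus;
`w > 0`, `c ≠ 0`, standing range, `2 ≤ d`. [cite: BalabanImbrieJaffe1985, (3.16)–(3.18) p.307] -/
theorem eq317_torus (hd : 2 ≤ P.d) (hk : k ≤ P.m + P.K) (hw : 0 < w) (hc : c ≠ 0) (l : ℝ) (F : UnitPlaqSpace P k)
    (x : V411 P k) :
    BIJ85AppAStatements.hForm (curlOp (P := P) w c ∘ₗ (V411 P k).subtype) (l • QesOp (P := P) hd w k F)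
        (x + -(l • formInv (curlOp (P := P) w c ∘ₗ (V411 P k).subtype)
          (LinearMap.adjoint (curlOp (P := P) w c ∘ₗ (V411 P k).subtype) (QesOp (P := P) hd w k F)))) =
      (1 / 2) * ‖(curlOp (P := P) w c ∘ₗ (V411 P k).subtype) x‖ ^ 2 +
        (1 / 2) * ⟪F, (l ^ 2 • sigmaTorus (P := P) hd w c k) F⟫ :=
  BIJ85Eq317Proof.eq317 _ _ (fun y z => (LinearMap.adjoint_inner_right _ y z).symm) _ (curlAdj_curl_C hk hw hc)
    (LinearMap.adjoint (QesOp (P := P) hd w k)) _ (fun f g => LinearMap.adjoint_inner_left _ g f) l _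
    (by rw [sigmaTorus_eq_320]) F x

/-- **(3.19): "This scaling absorbs the factor L^{−d}, so 𝒮_L⟨F,ΣF⟩ = ⟨f^{(1)}, σ₁f^{(1)}⟩"** — on the torus the operator `Σ =
L^{−d}•sigmaTorus hd 1 1 1` of (3.18) (unit weights) IS `σ₁ = sigmaTorus hd (η^d) 1 1` of (3.20)/(4.2.2) (the k = 1 step's physical weight
`w = η^d = L^{−d}`): seat p30's `sigmaTorus_scale_w` (σ_k linear in the weight); standing range. [cite: BalabanImbrieJaffe1985, (3.19) p.307] -/
theorem Sigma318_eq_sigmaOne (hd : 2 ≤ P.d) (h1 : 1 ≤ P.m + P.K) :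
    (P.eta 1) ^ P.d • sigmaTorus (P := P) hd 1 1 1 = sigmaTorus (P := P) hd ((P.eta 1) ^ P.d) 1 1 := by
  rw [← sigmaTorus_scale_w hd h1 (pow_pos (eta_pos P 1) _) one_pos one_ne_zero one_ne_zero, mul_one]

/-- **(3.17) ⟶ (3.19)–(3.20) in Sect. 3's own units** (k = 1; unit weights on `T₁`, `w = 1`; unit curl `c = 1`; `l = L^{−d/2}`, `l² =
L^{−d} = η^d`, η = L^{−1}): `½‖∂(A + A_cl) + L^{−d/2}Q^{e*}F‖² = ½‖∂A‖² + ½⟨F, σ₁F⟩` with the Σ of (3.18) (`= L^{−d}•sigmaTorus hd 1 1 1`)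
replaced by σ₁ = THE TORUS σ_k OF (4.2.2) AT k = 1 (`sigmaTorus hd (η^d) 1 1`) — *"(4.2.2) agrees with (3.20)"*; standing range `1 ≤ m + K`.
[cite: BalabanImbrieJaffe1985, (3.19)–(3.20) p.307] -/
theorem eq317_sigmaOne (hd : 2 ≤ P.d) (h1 : 1 ≤ P.m + P.K) (F : UnitPlaqSpace P 1) (x : V411 P 1) :
    BIJ85AppAStatements.hForm (curlOp (P := P) 1 1 ∘ₗ (V411 P 1).subtype)
        (Real.sqrt ((P.eta 1) ^ P.d) • QesOp (P := P) hd 1 1 F)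
        (x + -(Real.sqrt ((P.eta 1) ^ P.d) • formInv (curlOp (P := P) 1 1 ∘ₗ (V411 P 1).subtype)
          (LinearMap.adjoint (curlOp (P := P) 1 1 ∘ₗ (V411 P 1).subtype) (QesOp (P := P) hd 1 1 F)))) =
      (1 / 2) * ‖(curlOp (P := P) 1 1 ∘ₗ (V411 P 1).subtype) x‖ ^ 2 +
        (1 / 2) * ⟪F, sigmaTorus (P := P) hd ((P.eta 1) ^ P.d) 1 1 F⟫ := by
  rw [eq317_torus hd h1 one_pos one_ne_zero, Real.sq_sqrt (pow_nonneg (eta_pos P 1).le _), Sigma318_eq_sigmaOne hd h1]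

end KOne

end Literature.MathematicalPhysics.QuantumFieldTheory.BalabanImbrieJaffe1984to88.BIJ85Sigma422Eta
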